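import Summits.QuantumFields.YangMills.Theses.DualityDefect

/-!
# Strategy census (kernel-checked part) for crux `PeakSetsTheGap` (stmt-QuantumFields-11696)

Redirect strategist r1 (`planner-cstrat-stmt-QuantumFields-11696-r1-0`, 2026-08-17), route
`route-QuantumFields-DualityDefect`, sub-problem `YangMills`. Companion of `STRATEGY-CENSUS.md`.

Everything in this file is `sorry`-free. It pins down WHAT the crux `C := PeakSetsTheGap` ("ONE
NON-PERTURBATIVE SCALE": for `β ≥ β₀`, every infinite-volume limit state `μ`, every `t ≥ t₀` from
which the clover channel ratio `R = B/A` is non-increasing for good, `A(n) ≤ K e^{-c₁ n/t}`) says,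
relative to two plainly-named statements:

* `ScalarLatticeGap` (G) — the WEAK-COUPLING INFINITE-VOLUME LATTICE MASS GAP of the `0⁺⁺` clover
  channel: for every compact simple `G`, faithful unitary `r`, all `β ≥ β₀` and every limit state,
  `Cov_μ(S₀, S_{ne₀}) ≤ K e^{-m n}` for some `m(β, μ) > 0` (literally the registered stub
  `stub_scalarClustering` of `Lines/birth.lean`; Jaffe–Witten §5 / Chatterjee arXiv:1803.01950 §6:
  open for every non-abelian `G` at large `β`; in the tree only at strong coupling,
  `osterwalderSeiler_clustering`).
* `OneScaleLeg` (U) — the route-specific inequality `t_last ≥ c₁ ξ_S` (literally the registered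
  stub `stub_turnBeyondCorrelationLength`).

Kernel-checked relations (this file):

1. `oneScaleLeg_of_peakSetsTheGap : PeakSetsTheGap → OneScaleLeg` (downward closure of rates;
   constant `c₁/2`).
2. `scalarLatticeGap_of_peakSetsTheGap_of_infraredFall : PeakSetsTheGap → InfraredFall →
   ScalarLatticeGap` — with the route's OWN rank-2 sibling crux (the spectral ordering "R
   eventually falls", which by itself asserts no decay), the crux delivers exactly the
   weak-coupling lattice mass gap of the scalar channel for every `(G, r, β ≥ β₀, μ)`.
3. `peakSetsTheGap_of_scalarLatticeGap_of_oneScaleLeg : ScalarLatticeGap → OneScaleLeg →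
   PeakSetsTheGap` (the birth composition, re-proved here so that this file is self-contained).
   With 1–2: modulo `InfraredFall`, `PeakSetsTheGap ⟺ ScalarLatticeGap ∧ OneScaleLeg`.
4. `peakSetsTheGap_of_afScaledGapWithUVRise : AFScaledGapWithUVRise → PeakSetsTheGap` — the only
   sufficient road anyone can name for U (and C): a UV window `[t₀, ℓ(β)]` on which `R` keeps
   rising (the sibling `UltravioletRise`, lattice perturbation theory two orders past UV
   stability) AND a scalar gap `≥ c/ℓ(β)` in EVERY weak-coupling state — with `ℓ(β) ~ e^{κβ}` the
   perturbative length this second conjunct is the lattice mass gap WITH ASYMPTOTIC-FREEDOM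
   SCALING (`m(β) ≥ c e^{-κβ}`), the quantitative infrared core of the Millennium problem.
5. `settledRatio_does_not_force_decay` — the hypothesis of the crux is inert: positive,
   log-convex (reflection-positivity-shaped) sequences `A ≡ 1`, `B = 2⁻ⁿ` have their ratio
   falling strictly from `n = 0` on, yet `A` has no exponential rate. So no general property of a
   PAIR of RP channels yields C; C needs Yang–Mills-specific non-perturbative control of the top
   of the scalar spectral measure at weak coupling — the gap.

BC2 probes (folder `bc/`): `PeakSetsTheGap → YangMills` FAILS (exact? / aesop / simpa / aesop
without simp: 4/4; BC7 P5 `C→S` 7/7 tactics fail, VERDICT CLEAN) and `YangMills → PeakSetsTheGap`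
FAILS (3/3; P5 `S→C` 6/6 + 1 deadline): the crux is formally incomparable with the summit — it
has no continuum / OS / all-observable content at all (that is carried verbatim by the sibling
`DefectRemainderToClay = (X → YangMills)`), while in the `∀ r, ∀ β ≥ β₀` directions it exceeds
what `YangMills` consumes. Its content is the lattice mass gap in the units `t ↔ ξ_S`.
-/

set_option autoImplicit false

noncomputable section

namespace Summit.QuantumFields.YangMills.Cruxes.PeakSetsTheGap.Census

open MeasureTheory Filter
open Literature.MathematicalPhysics.QuantumLattice Literature.MathematicalPhysics.QuantumFieldTheory
open Summit.QuantumFields.YangMills.Theses.DualityDefect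

/-! ## The two plainly-named statements -/

/-- **G — weak-coupling lattice mass gap of the scalar clover channel** (= the statement of the
registered stub `stub_scalarClustering`, `Lines/birth.lean`): for every compact simple `G`,
faithful unitary `r`, there is `β₀` such that for all `β ≥ β₀` and every infinite-volume limit
state `μ` the axis covariance `A(n) = Cov_μ(S₀, S_{n e₀})` of the bare clover action density has
SOME exponential rate `m(β, μ) > 0`. Open (Jaffe–Witten 2000 §5; Chatterjee arXiv:1803.01950 §6);
in the tree only at strong coupling (`osterwalderSeiler_clustering`). -/
def ScalarLatticeGap : Prop :=
  ∀ (G : Type) [Group G] [TopologicalSpace G] [IsTopologicalGroup G] [CompactSpace G] [MeasurableSpace G] [BorelSpace G], IsCompactSimpleLieGroup G → ∀ r : LatticeRep G, let S : (Fin 4 → ℤ) → LGConfig 4 G → ℝ := fun x U => flowedCloverEnergy r.ρ 0 x U; let e : ℕ → (Fin 4 → ℤ) := fun n => (n : ℤ) • Pi.single (0 : Fin 4) (1 : ℤ); let A : Measure (LGConfig 4 G) → ℕ → ℝ := fun μ n => integral μ (fun U => S 0 U * S (e n) U) - integral μ (fun U => S 0 U) * integral μ (fun U => S (e n) U); ∃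 β₀ : ℝ, ∀ β : ℝ, β₀ ≤ β → ∀ μ ∈ infiniteVolumeLimitPoints (d := 4) r.ρ β, ∃ m : ℝ, 0 < m ∧ ∃ K : ℝ, ∀ n : ℕ, A μ n ≤ K * Real.exp (-(m * n))

/-- **U — the one-scale leg** (= the statement of the registered stub
`stub_turnBeyondCorrelationLength`): for `β ≥ β₀`, every limit state, every for-good turning time
`t ≥ t₀` of `R = B/A` and every near-optimal rate `m` of `A μ` (`m` a rate, `2m` not):
`c₁ ≤ m t`, i.e. `t_last ≥ c₁ ξ_S` up to a factor 2. -/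
def OneScaleLeg : Prop :=
  ∀ (G : Type) [Group G] [TopologicalSpace G] [IsTopologicalGroup G] [CompactSpace G] [MeasurableSpace G] [BorelSpace G], IsCompactSimpleLieGroup G → ∀ r : LatticeRep G, let S : (Fin 4 → ℤ) → LGConfig 4 G → ℝ := fun x U => flowedCloverEnergy r.ρ 0 x U; let P : (Fin 4 → ℤ) → LGConfig 4 G → ℝ := fun x U => -2 * (flowedClover r.ρ 0 U x 0 1 * flowedClover r.ρ 0 U x 2 3 - flowedClover r.ρ 0 U x 0 2 * flowedClover r.ρ 0 U x 1 3 + flowedClover r.ρ 0 U x 0 3 * flowedClover r.ρ 0 U x 1 2).trace.re; let e : ℕ → (Fin 4 → ℤ) := fun n => (n : ℤ) • Pi.single (0 : Fin 4) (1 : ℤ); let A : Measure (LGConfig 4 G) → ℕ → ℝ := fun μ n => integral μ (fun U => S 0 U * S (e n) U) - integral μ (fun U => S 0 U) * integral μ (fun U => S (e n) U); let B : Measure (LGConfig 4 G) → ℕ → ℝ := fun μ n => integral μ (fun U => P 0 U) * integral μ (fun U => P (e n) U) - integral μ (fun U => P 0 U * P (e n) U); ∃ (β₀ c₁ : ℝ)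 (t₀ : ℕ), 0 < c₁ ∧ 0 < t₀ ∧ ∀ β : ℝ, β₀ ≤ β → ∀ μ ∈ infiniteVolumeLimitPoints (d := 4) r.ρ β, ∀ t : ℕ, t₀ ≤ t → (∀ n : ℕ, t ≤ n → B μ (n + 1) * A μ n ≤ B μ n * A μ (n + 1)) → ∀ m : ℝ, 0 < m → (∃ K : ℝ, ∀ n : ℕ, A μ n ≤ K * Real.exp (-(m * n))) → (∀ K : ℝ, ∃ n : ℕ, K * Real.exp (-(2 * m * n)) < A μ n) → c₁ ≤ m * t

/-- **The named sufficient road: AF-scaled lattice gap + UV rise, sharing one length `ℓ(β)`.**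
For every `(G, r)` there are a window length `ℓ : ℝ → ℕ`, `c > 0`, `β₀`, `t₀ > 0` with, for
`β ≥ β₀`: `ℓ(β) > 0`; (RISE) in every limit state, at or beyond every `t₀ ≤ t ≤ ℓ(β)` the ratio
`R` still has a strict rise (`B(n)A(n+1) < B(n+1)A(n)` for some `n ≥ t`) — the content of the
sibling `UltravioletRise`; (GAP) in every limit state the scalar channel decays at rate
`≥ c/ℓ(β)`: `A(n) ≤ K e^{-c n/ℓ(β)}`. With `ℓ(β) ≍ e^{κβ}` (the only scale to which a rise can be
certified, by lattice perturbation theory) GAP reads `m_S(β, μ) ≥ c e^{-κβ}`: the lattice mass gap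
with asymptotic-freedom scaling, uniformly over states — the quantitative infrared core of the
Millennium problem (Jaffe–Witten 2000 §5; Chatterjee arXiv:1803.01950, open problems §6). -/
def AFScaledGapWithUVRise : Prop :=
  ∀ (G : Type) [Group G] [TopologicalSpace G] [IsTopologicalGroup G] [CompactSpace G] [MeasurableSpace G] [BorelSpace G], IsCompactSimpleLieGroup G → ∀ r : LatticeRep G, let S : (Fin 4 → ℤ) → LGConfig 4 G → ℝ := fun x U => flowedCloverEnergy r.ρ 0 x U; let P : (Fin 4 → ℤ) → LGConfig 4 G → ℝ := fun x U => -2 * (flowedClover r.ρ 0 U x 0 1 * flowedClover r.ρ 0 U x 2 3 - flowedClover r.ρ 0 U x 0 2 * flowedClover r.ρ 0 U x 1 3 + flowedClover r.ρ 0 U x 0 3 * flowedClover r.ρ 0 U x 1 2).trace.re; let e : ℕ → (Fin 4 → ℤ) := fun n => (n : ℤ) • Pi.single (0 : Fin 4) (1 : ℤ); let A : Measure (LGConfig 4 G) → ℕ → ℝ := fun μ n => integral μ (fun U => S 0 U * S (e n) U) - integral μ (fun U => S 0 U) * integral μ (fun U => S (e n) U); let B : Measure (LGConfig 4 G) → ℕ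 → ℝ := fun μ n => integral μ (fun U => P 0 U) * integral μ (fun U => P (e n) U) - integral μ (fun U => P 0 U * P (e n) U); ∃ (ℓ : ℝ → ℕ) (c β₀ : ℝ) (t₀ : ℕ), 0 < c ∧ 0 < t₀ ∧ (∀ β : ℝ, β₀ ≤ β → 0 < ℓ β) ∧ (∀ β : ℝ, β₀ ≤ β → ∀ μ ∈ infiniteVolumeLimitPoints (d := 4) r.ρ β, ∀ t : ℕ, t₀ ≤ t → t ≤ ℓ β → ∃ n : ℕ, t ≤ n ∧ B μ n * A μ (n + 1) < B μ (n + 1) * A μ n) ∧ (∀ β : ℝ, β₀ ≤ β → ∀ μ ∈ infiniteVolumeLimitPoints (d := 4) r.ρ β, ∃ K : ℝ, ∀ n : ℕ, A μ n ≤ K * Real.exp (-(c * n / ℓ β)))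

/-! ## Pure real analysis (abstract over any admissible-state family `adm : ℝ → Set M`) -/

section Abstract

variable {M : Type*}

/-- Rescaling a clustering bound: a rate `m` with `c ≤ m t` gives the rate `c/t`
(constant `max K 0`). (Copied from `Lines/birth.lean`.) -/
theorem rate_rescale {a : ℕ → ℝ} {m c : ℝ} {t : ℕ} (ht : 0 < t) (hcm : c ≤ m * t)
    (h : ∃ K : ℝ, ∀ n : ℕ, a n ≤ K * Real.exp (-(m * n))) :
    ∃ K : ℝ, ∀ n : ℕ, a n ≤ K * Real.exp (-(c * n / t)) := by
  obtain ⟨K, hK⟩ := h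
  have htR : (0 : ℝ) < t := by exact_mod_cast ht
  refine ⟨max K 0, fun n => ?_⟩
  have hn : (0 : ℝ) ≤ n := n.cast_nonneg
  have hle : c * n / t ≤ m * n := by
    rw [div_le_iff₀ htR]
    calc c * (n : ℝ) ≤ m * t * n := mul_le_mul_of_nonneg_right hcm hn
      _ = m * n * t := by ring
  have hexp : Real.exp (-(m * n)) ≤ Real.exp (-(c * n / t)) := Real.exp_le_exp.mpr (by linarith)
  calc a n ≤ K * Real.exp (-(m * n)) := hK n
    _ ≤ max K 0 * Real.exp (-(m * n)) :=
        mul_le_mul_of_nonneg_right (le_max_left _ _) (Real.exp_nonneg _)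
    _ ≤ max K 0 * Real.exp (-(c * n / t)) := mul_le_mul_of_nonneg_left hexp (le_max_right _ _)

/-- **(1, abstract) the crux implies the one-scale leg** (constant `c₁/2`): if `c₁/t` is a rate of
`A μ` and `2m` is not, then `2m > c₁/t`; rates are downward closed. -/
theorem oneScale_of_peak (adm : ℝ → Set M) (A B : M → ℕ → ℝ)
    (hC : ∃ (β₀ c₁ : ℝ) (t₀ : ℕ), 0 < c₁ ∧ 0 < t₀ ∧ ∀ β : ℝ, β₀ ≤ β → ∀ μ ∈ adm β, ∀ t : ℕ, t₀ ≤ t →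
      (∀ n : ℕ, t ≤ n → B μ (n + 1) * A μ n ≤ B μ n * A μ (n + 1)) →
      ∃ K : ℝ, ∀ n : ℕ, A μ n ≤ K * Real.exp (-(c₁ * n / t))) :
    ∃ (β₀ c₁ : ℝ) (t₀ : ℕ), 0 < c₁ ∧ 0 < t₀ ∧ ∀ β : ℝ, β₀ ≤ β → ∀ μ ∈ adm β, ∀ t : ℕ, t₀ ≤ t →
      (∀ n : ℕ, t ≤ n → B μ (n + 1) * A μ n ≤ B μ n * A μ (n + 1)) →
      ∀ m : ℝ, 0 < m → (∃ K : ℝ, ∀ n : ℕ, A μ n ≤ K * Real.exp (-(m * n))) →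
      (∀ K : ℝ, ∃ n : ℕ, K * Real.exp (-(2 * m * n)) < A μ n) → c₁ ≤ m * t := by
  obtain ⟨β₀, c₁, t₀, hc₁, ht₀, hC⟩ := hC
  refine ⟨β₀, c₁ / 2, t₀, by positivity, ht₀, ?_⟩
  intro β hβ μ hμ t ht hturn m hm _ hnot
  obtain ⟨K, hK⟩ := hC β hβ μ hμ t ht hturn
  have htpos : 0 < t := lt_of_lt_of_le ht₀ ht
  have htR : (0 : ℝ) < t := by exact_mod_cast htpos
  by_contra hlt
  push Not at hlt
  -- then `2m ≤ c₁/t`, so `2m` IS a rate (constant `max K 0`): contradiction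
  have h2m : 2 * m * t ≤ c₁ := by nlinarith
  have hrate : ∃ K' : ℝ, ∀ n : ℕ, A μ n ≤ K' * Real.exp (-(2 * m * n)) := by
    refine ⟨max K 0, fun n => ?_⟩
    have hn : (0 : ℝ) ≤ n := n.cast_nonneg
    have hle : 2 * m * n ≤ c₁ * n / t := by
      rw [le_div_iff₀ htR]
      calc 2 * m * n * t = 2 * m * t * n := by ring
        _ ≤ c₁ * n := mul_le_mul_of_nonneg_right h2m hn
    have hexp : Real.exp (-(c₁ * n / t)) ≤ Real.exp (-(2 * m * n)) :=
      Real.exp_le_exp.mpr (by linarith)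
    calc A μ n ≤ K * Real.exp (-(c₁ * n / t)) := hK n
      _ ≤ max K 0 * Real.exp (-(c₁ * n / t)) :=
          mul_le_mul_of_nonneg_right (le_max_left _ _) (Real.exp_nonneg _)
      _ ≤ max K 0 * Real.exp (-(2 * m * n)) := mul_le_mul_of_nonneg_left hexp (le_max_right _ _)
  obtain ⟨K', hK'⟩ := hrate
  obtain ⟨n, hn⟩ := hnot K'
  exact absurd (hK' n) (not_le.mpr hn)

/-- **(2, abstract) crux + eventual strict fall ⟹ per-state gap**: take the turning time
`t = max t₀ n₀` supplied by the fall; the crux then gives the rate `c₁/t > 0`. -/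
theorem gap_of_peak_of_fall (adm : ℝ → Set M) (A B : M → ℕ → ℝ)
    (hC : ∃ (β₀ c₁ : ℝ) (t₀ : ℕ), 0 < c₁ ∧ 0 < t₀ ∧ ∀ β : ℝ, β₀ ≤ β → ∀ μ ∈ adm β, ∀ t : ℕ, t₀ ≤ t →
      (∀ n : ℕ, t ≤ n → B μ (n + 1) * A μ n ≤ B μ n * A μ (n + 1)) →
      ∃ K : ℝ, ∀ n : ℕ, A μ n ≤ K * Real.exp (-(c₁ * n / t)))
    (hF : ∀ β : ℝ, 0 < β → ∀ μ ∈ adm β, ∃ n₀ : ℕ, ∀ n : ℕ, n₀ ≤ n →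
      0 < A μ n ∧ 0 < B μ n ∧ B μ (n + 1) * A μ n < B μ n * A μ (n + 1)) :
    ∃ β₀ : ℝ, ∀ β : ℝ, β₀ ≤ β → ∀ μ ∈ adm β,
      ∃ m : ℝ, 0 < m ∧ ∃ K : ℝ, ∀ n : ℕ, A μ n ≤ K * Real.exp (-(m * n)) := by
  obtain ⟨β₀, c₁, t₀, hc₁, ht₀, hC⟩ := hC
  refine ⟨max β₀ 1, fun β hβ μ hμ => ?_⟩
  have hβ₀ : β₀ ≤ β := le_trans (le_max_left _ _) hβ
  have hβpos : 0 < β := lt_of_lt_of_le one_pos (le_trans (le_max_right _ _) hβ)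
  obtain ⟨n₀, hn₀⟩ := hF β hβpos μ hμ
  have htt₀ : t₀ ≤ max t₀ n₀ := le_max_left _ _
  have hturn : ∀ n : ℕ, max t₀ n₀ ≤ n → B μ (n + 1) * A μ n ≤ B μ n * A μ (n + 1) :=
    fun n hn => (hn₀ n (le_trans (le_max_right _ _) hn)).2.2.le
  obtain ⟨K, hK⟩ := hC β hβ₀ μ hμ (max t₀ n₀) htt₀ hturn
  have htpos : (0 : ℝ) < (max t₀ n₀ : ℕ) := by exact_mod_cast lt_of_lt_of_le ht₀ htt₀
  refine ⟨c₁ / (max t₀ n₀ : ℕ), div_pos hc₁ htpos, K, fun n => ?_⟩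
  have h : c₁ / (max t₀ n₀ : ℕ) * n = c₁ * n / (max t₀ n₀ : ℕ) := by ring
  rw [h]
  exact hK n

/-- **(3, abstract) gap ∧ one-scale ⟹ crux** — the birth composition `peak_of_rates`
(doubling ladder), copied from `Lines/birth.lean` so that this census is self-contained. -/
theorem peak_of_rates (adm : ℝ → Set M) (A B : M → ℕ → ℝ)
    (hG : ∃ β₀ : ℝ, ∀ β : ℝ, β₀ ≤ β → ∀ μ ∈ adm β,
      ∃ m : ℝ, 0 < m ∧ ∃ K : ℝ, ∀ n : ℕ, A μ n ≤ K * Real.exp (-(m * n)))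
    (hU : ∃ (β₀ c₁ : ℝ) (t₀ : ℕ), 0 < c₁ ∧ 0 < t₀ ∧ ∀ β : ℝ, β₀ ≤ β → ∀ μ ∈ adm β, ∀ t : ℕ, t₀ ≤ t →
      (∀ n : ℕ, t ≤ n → B μ (n + 1) * A μ n ≤ B μ n * A μ (n + 1)) →
      ∀ m : ℝ, 0 < m → (∃ K : ℝ, ∀ n : ℕ, A μ n ≤ K * Real.exp (-(m * n))) →
      (∀ K : ℝ, ∃ n : ℕ, K * Real.exp (-(2 * m * n)) < A μ n) → c₁ ≤ m * t) :
    ∃ (β₀ c₁ : ℝ) (t₀ : ℕ), 0 < c₁ ∧ 0 < t₀ ∧ ∀ β : ℝ, β₀ ≤ β → ∀ μ ∈ adm β, ∀ t : ℕ, t₀ ≤ t →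
      (∀ n : ℕ, t ≤ n → B μ (n + 1) * A μ n ≤ B μ n * A μ (n + 1)) →
      ∃ K : ℝ, ∀ n : ℕ, A μ n ≤ K * Real.exp (-(c₁ * n / t)) := by
  obtain ⟨β₁, hG⟩ := hG
  obtain ⟨β₂, c₁, t₀, hc₁, ht₀, hU⟩ := hU
  refine ⟨max β₁ β₂, c₁, t₀, hc₁, ht₀, ?_⟩
  intro β hβ μ hμ t ht hturn
  have hβ₁ : β₁ ≤ β := le_trans (le_max_left _ _) hβ
  have hβ₂ : β₂ ≤ β := le_trans (le_max_right _ _) hβ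
  have htpos : 0 < t := lt_of_lt_of_le ht₀ ht
  have htR : (0 : ℝ) < t := by exact_mod_cast htpos
  obtain ⟨m₀, hm₀, hrate₀⟩ := hG β hβ₁ μ hμ
  have key : ∀ k : ℕ, (∃ K : ℝ, ∀ n : ℕ, A μ n ≤ K * Real.exp (-(2 ^ k * m₀ * n))) ∨
      ∃ K : ℝ, ∀ n : ℕ, A μ n ≤ K * Real.exp (-(c₁ * n / t)) := by
    intro k
    induction k with
    | zero =>
      left
      obtain ⟨K, hK⟩ := hrate₀
      exact ⟨K, fun n => by simpa using hK n⟩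
    | succ j ih =>
      rcases ih with hRj | hdone
      · by_cases hRj1 : ∃ K : ℝ, ∀ n : ℕ, A μ n ≤ K * Real.exp (-(2 ^ (j + 1) * m₀ * n))
        · exact Or.inl hRj1
        · right
          have hnot : ∀ K : ℝ, ∃ n : ℕ, K * Real.exp (-(2 * (2 ^ j * m₀) * n)) < A μ n := by
            intro K
            by_contra hcon
            push Not at hcon
            refine hRj1 ⟨K, fun n => ?_⟩
            have e2 : (2 : ℝ) ^ (j + 1) * m₀ * n = 2 * (2 ^ j * m₀) * n := by ring
            rw [e2]
            exact hcon n
          have hmj : (0 : ℝ) < 2 ^ j * m₀ := by positivity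
          have hc : c₁ ≤ 2 ^ j * m₀ * t := hU β hβ₂ μ hμ t ht hturn (2 ^ j * m₀) hmj hRj hnot
          exact rate_rescale htpos hc hRj
      · exact Or.inr hdone
  obtain ⟨k, hk⟩ : ∃ k : ℕ, c₁ ≤ 2 ^ k * m₀ * t := by
    obtain ⟨k, hk⟩ := pow_unbounded_of_one_lt (c₁ / (m₀ * t)) (by norm_num : (1 : ℝ) < 2)
    refine ⟨k, ?_⟩
    have hmt : (0 : ℝ) < m₀ * t := mul_pos hm₀ htR
    have h1 : c₁ < 2 ^ k * (m₀ * t) := (div_lt_iff₀ hmt).mp hk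
    calc c₁ ≤ 2 ^ k * (m₀ * t) := h1.le
      _ = 2 ^ k * m₀ * t := by ring
  rcases key k with hRk | hdone
  · exact rate_rescale htpos hk hRk
  · exact hdone

/-- **(4, abstract) AF-scaled gap + UV rise (one shared length `ℓ`) ⟹ crux**: a for-good turning
time `t` cannot lie in the rising window, so `t > ℓ(β)`, and the rate `c/ℓ(β)` beats `c/t`. -/
theorem peak_of_gapAtScale_of_riseToScale (adm : ℝ → Set M) (A B : M → ℕ → ℝ)
    (h : ∃ (ℓ : ℝ → ℕ) (c β₀ : ℝ) (t₀ : ℕ), 0 < c ∧ 0 < t₀ ∧ (∀ β : ℝ, β₀ ≤ β → 0 < ℓ β) ∧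
      (∀ β : ℝ, β₀ ≤ β → ∀ μ ∈ adm β, ∀ t : ℕ, t₀ ≤ t → t ≤ ℓ β →
        ∃ n : ℕ, t ≤ n ∧ B μ n * A μ (n + 1) < B μ (n + 1) * A μ n) ∧
      (∀ β : ℝ, β₀ ≤ β → ∀ μ ∈ adm β, ∃ K : ℝ, ∀ n : ℕ, A μ n ≤ K * Real.exp (-(c * n / ℓ β)))) :
    ∃ (β₀ c₁ : ℝ) (t₀ : ℕ), 0 < c₁ ∧ 0 < t₀ ∧ ∀ β : ℝ, β₀ ≤ β → ∀ μ ∈ adm β, ∀ t : ℕ, t₀ ≤ t →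
      (∀ n : ℕ, t ≤ n → B μ (n + 1) * A μ n ≤ B μ n * A μ (n + 1)) →
      ∃ K : ℝ, ∀ n : ℕ, A μ n ≤ K * Real.exp (-(c₁ * n / t)) := by
  obtain ⟨ℓ, c, β₀, t₀, hc, ht₀, hℓ, hrise, hgap⟩ := h
  refine ⟨β₀, c, t₀, hc, ht₀, ?_⟩
  intro β hβ μ hμ t ht hturn
  have hℓpos : 0 < ℓ β := hℓ β hβ
  -- the turning time lies beyond the rising window
  have hℓt : ℓ β < t := by
    by_contra hle
    push Not at hle
    obtain ⟨n, htn, hlt⟩ := hrise β hβ μ hμ t ht hle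
    exact absurd (hturn n htn) (not_le.mpr hlt)
  have htpos : 0 < t := lt_of_lt_of_le ht₀ ht
  obtain ⟨K, hK⟩ := hgap β hβ μ hμ
  -- rate `c/ℓ β` with `c ≤ (c/ℓ β) * t`
  have hℓR : (0 : ℝ) < (ℓ β : ℕ) := by exact_mod_cast hℓpos
  have hcm : c ≤ c / (ℓ β : ℕ) * t := by
    rw [div_mul_eq_mul_div, le_div_iff₀ hℓR]
    have : ((ℓ β : ℕ) : ℝ) ≤ (t : ℝ) := by exact_mod_cast hℓt.le
    exact mul_le_mul_of_nonneg_left this hc.le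
  refine rate_rescale htpos hcm ⟨K, fun n => ?_⟩
  have e : c / (ℓ β : ℕ) * n = c * n / (ℓ β : ℕ) := by ring
  rw [e]
  exact hK n

end Abstract

/-! ## Instantiations BY NAME on the route's decls -/

/-- **(1) The crux implies the one-scale leg.** -/
theorem oneScaleLeg_of_peakSetsTheGap : PeakSetsTheGap → OneScaleLeg := by
  intro hC G _ _ _ _ _ _ hG r S P e A B
  exact oneScale_of_peak (infiniteVolumeLimitPoints (d := 4) r.ρ) A B (hC G hG r)

/-- **(2) COSTUME THEOREM.** The crux together with the route's own rank-2 sibling `InfraredFall`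
(spectral ordering only: "R eventually falls strictly"; it asserts no decay of anything) yields
the weak-coupling infinite-volume lattice mass gap of the scalar clover channel for every compact
simple `G`, every faithful unitary `r`, all `β ≥ β₀` and every limit state. -/
theorem scalarLatticeGap_of_peakSetsTheGap_of_infraredFall :
    PeakSetsTheGap → InfraredFall → ScalarLatticeGap := by
  intro hC hF G _ _ _ _ _ _ hG r S e A
  let P : (Fin 4 → ℤ) → LGConfig 4 G → ℝ := fun x U => -2 * (flowedClover r.ρ 0 U x 0 1 * flowedClover r.ρ 0 U x 2 3 - flowedClover r.ρ 0 U x 0 2 * flowedClover r.ρ 0 U x 1 3 + flowedClover r.ρ 0 U x 0 3 * flowedClover r.ρ 0 U x 1 2).trace.re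
  let B : Measure (LGConfig 4 G) → ℕ → ℝ := fun μ n => integral μ (fun U => P 0 U) * integral μ (fun U => P (e n) U) - integral μ (fun U => P 0 U * P (e n) U)
  exact gap_of_peak_of_fall (infiniteVolumeLimitPoints (d := 4) r.ρ) A B (hC G hG r) (hF G hG r)

/-- **(3) Gap ∧ one-scale ⟹ crux** (the registered birth composition, here from the statements). -/
theorem peakSetsTheGap_of_scalarLatticeGap_of_oneScaleLeg :
    ScalarLatticeGap → OneScaleLeg → PeakSetsTheGap := by
  intro hG' hU G _ _ _ _ _ _ hG r S P e A B
  exact peak_of_rates (infiniteVolumeLimitPoints (d := 4) r.ρ) A B (hG' G hG r) (hU G hG r)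

/-- **(2+3) Modulo `InfraredFall`, the crux IS `ScalarLatticeGap ∧ OneScaleLeg`.** -/
theorem peakSetsTheGap_iff_gap_and_oneScale_of_infraredFall (hF : InfraredFall) :
    PeakSetsTheGap ↔ ScalarLatticeGap ∧ OneScaleLeg :=
  ⟨fun hC => ⟨scalarLatticeGap_of_peakSetsTheGap_of_infraredFall hC hF,
    oneScaleLeg_of_peakSetsTheGap hC⟩,
    fun h => peakSetsTheGap_of_scalarLatticeGap_of_oneScaleLeg h.1 h.2⟩

/-- **(4) The named sufficient road** — AF-scaled lattice gap + UV rise ⟹ crux. -/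
theorem peakSetsTheGap_of_afScaledGapWithUVRise : AFScaledGapWithUVRise → PeakSetsTheGap := by
  intro h G _ _ _ _ _ _ hG r S P e A B
  exact peak_of_gapAtScale_of_riseToScale (infiniteVolumeLimitPoints (d := 4) r.ρ) A B (h G hG r)

/-! ## (5) The hypothesis of the crux is inert (abstract strengthening refuted) -/

/-- **The settled channel ordering forces no decay.** `A ≡ 1` (moments of `δ₁`: a scalar channel
with NO gap) and `B n = 2⁻ⁿ` (moments of `δ_{1/2}`) are positive and log-convex — everything
reflection positivity gives a pair of channels — and their ratio `R = B/A` falls strictly from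
`n = 0` on (so it is "non-increasing for good" from every `t`), yet `A` has no exponential rate.
Hence the measure-pair abstraction of `PeakSetsTheGap` ("settled from `t` ⟹ rate `c₁/t`") is
FALSE, and any proof of the crux must use Yang–Mills-specific non-perturbative control of the
top of the scalar spectral measure at weak coupling, i.e. the gap itself. -/
theorem settledRatio_does_not_force_decay :
    ∃ A B : ℕ → ℝ, (∀ n, 0 < A n) ∧ (∀ n, 0 < B n) ∧
      (∀ n, A (n + 1) * A (n + 1) ≤ A n * A (n + 2)) ∧ (∀ n, B (n + 1) * B (n + 1) ≤ B n * B (n + 2)) ∧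
      (∀ n, B (n + 1) * A n < B n * A (n + 1)) ∧
      ¬ ∃ m : ℝ, 0 < m ∧ ∃ K : ℝ, ∀ n : ℕ, A n ≤ K * Real.exp (-(m * n)) := by
  refine ⟨fun _ => 1, fun n => (1 / 2 : ℝ) ^ n, fun _ => one_pos, fun n => by positivity,
    fun n => by norm_num, fun n => ?_, fun n => ?_, ?_⟩
  · show (1 / 2 : ℝ) ^ (n + 1) * (1 / 2 : ℝ) ^ (n + 1) ≤ (1 / 2 : ℝ) ^ n * (1 / 2 : ℝ) ^ (n + 2)
    apply le_of_eq; ring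
  · show (1 / 2 : ℝ) ^ (n + 1) * 1 < (1 / 2 : ℝ) ^ n * 1
    have h : (1 / 2 : ℝ) ^ (n + 1) = (1 / 2 : ℝ) ^ n * (1 / 2) := pow_succ _ _
    rw [h]
    have hp : (0 : ℝ) < (1 / 2 : ℝ) ^ n := by positivity
    nlinarith
  · rintro ⟨m, hm, K, hK⟩
    replace hK : ∀ n : ℕ, (1 : ℝ) ≤ K * Real.exp (-(m * n)) := hK
    have ht : Tendsto (fun n : ℕ => K * Real.exp (-(m * (n : ℝ)))) atTop (nhds (K * 0)) := by
      refine Tendsto.const_mul K ?_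
      have h1 : Tendsto (fun n : ℕ => m * (n : ℝ)) atTop atTop :=
        Tendsto.const_mul_atTop hm tendsto_natCast_atTop_atTop
      exact Real.tendsto_exp_neg_atTop_nhds_zero.comp h1
    rw [mul_zero] at ht
    have hev : ∀ᶠ n : ℕ in atTop, K * Real.exp (-(m * (n : ℝ))) < 1 :=
      ht.eventually (Iio_mem_nhds one_pos)
    obtain ⟨n, hn⟩ := hev.exists
    exact absurd (hK n) (not_le.mpr hn)

/-- Signature matches (the census statements are literally the registered stubs' types and the
route decls): -/
example : ScalarLatticeGap → OneScaleLeg → Summit.QuantumFields.YangMills.Theses.DualityDefect.PeakSetsTheGap :=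
  peakSetsTheGap_of_scalarLatticeGap_of_oneScaleLeg

end Summit.QuantumFields.YangMills.Cruxes.PeakSetsTheGap.Census

end
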